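import Summits.Langlands.Langlands.Theorems.RamifiedCoefficientSeedAdjointLiftingGL3BirthDefs
import Literature.NumberTheory.Automorphic.ReciprocityGLnProofs
import Literature.NumberTheory.Automorphic.SerreConjecture
import Literature.NumberTheory.Automorphic.GelbartJacquetAdjointLiftArchimedean
import Literature.NumberTheory.GaloisRepresentations.AdZeroBlochKatoDatum
import Literature.NumberTheory.GaloisRepresentations.CalegariEvenFontaineMazurTwo
import Literature.NumberTheory.GaloisRepresentations.ProjectiveType
import Literature.NumberTheory.GaloisRepresentations.HeckeCharacter
import Literature.GroupTheory.SpecificGroups.PGL2DicksonCharP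
import HarnessLib

/-!
# Route `RamifiedCoefficientSeed`, crux `AdjointLiftingGL3` (stmt-Langlands-16779): vocabulary of the
# line `birth`, part 2 (skeleton v4 interfaces)

Second vocabulary file of the line (the first, `…BirthDefs.lean`, p161710, carries the crux's
clauses `CrysHT012`, `AdjointSeed`, `ScalarOffCyclotomic`, `TraceCongruent`, `WeightZeroSeedFor`).
Filed as a NEW module rather than an append to `…BirthDefs.lean` because two append proposals of
that file (p162786, p163881) sat unverified in the gate queue while five stub workers were waiting
for the names; whichever copy of these declarations lands second is redundant and will be withdrawn
by `dedup.fqn-exists`.  NOTHING IS ASSERTED: every `def … : Prop` is an interface between the stubs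
of skeleton v4 of `Cruxes/AdjointLiftingGL3/Lines/birth.lean` (S1 residual dictionary, S2 local
Fontaine–Laffaille analysis, S3 Dickson, S4 enormous, S5 automorphic adjoint seed, S6 Galois seed),
declared in the skeleton's namespace so that landed stubs read byte-identically to their
registration.  No import of the route module (closing cone).

Proved here: `glAdZeroTwoFrame_scalar` (`Ad` of a scalar matrix is the identity) and the glue
`scalarOffCyclotomic_of_isTwistedAdZero` (a scalar `τ₀ σ` off `Γ_{ℚ(ζ_p)}` gives a scalar `τ σ` for
every `τ = P(η̄ · Ad τ₀)P⁻¹`), the registered sub-goal carrying this file.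

References: ACCGHLNSTT2023 Thm. 6.1.1, Def. 6.2.28, §7.1; KhareWintenberger2009 Thm. 1.2;
GelbartJacquet1978 Thm. (9.3); HarrisLanTaylorThorneRMS2016 Thm. A.
-/

set_option linter.dupNamespace false -- `Summit.Langlands.Langlands` is the mandated namespace

noncomputable section

namespace Summit.Langlands.Langlands.Cruxes.AdjointLiftingGL3.Birth

open scoped MatrixGroups NumberField
open NumberField IsDedekindDomain Field Filter
open Literature.NumberTheory.GaloisRepresentations Literature.NumberTheory.PAdicHodge
open Literature.NumberTheory.Automorphic

/-! ## Skeleton v4 vocabulary (fine split of the two open stubs; appended 2026-08-17)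

The image core (B) and the same-weight seed (C) are cut along the paper proof into stubs that one
worker can prove: (S1) the residual dictionary `τ ≅ η̄ ⊗ ad⁰(τ̄₀)`; (S2) the LOCAL Fontaine–Laffaille
analysis at `p` (projective inertia element of order `> 5`, the Teichmüller twist `μ ≡ η ε`, the
weight-two newform via Khare–Wintenberger); (S3) Dickson: big projective image on `Γ_{ℚ(ζ_p)}` and
the scalar element; (S4) ACC+ §7.1: enormous; (S5) the automorphic seed `Ad(π_g) ⊗ χ`
(Gelbart–Jacquet, weight zero, unramified at `p`); (S6) the Galois seed (HLTT Thm. A + trace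
identification).  The `Prop`s below are the INTERFACES between these stubs; again nothing is
asserted. -/

section V4

open Literature.NumberTheory.EllipticCurves.ModularForms CongruenceSubgroup
open scoped Pointwise

/-- **`ad⁰` of a two-dimensional homomorphism in the fixed frame**: `g ↦ Ad(τ₀ g)` on trace-zero
`2 × 2` matrices in the basis of the accepted `glAdZeroTwoFrame` (the frame in which
`FramedRep.adZeroTwoTwist` is written, `charpoly_adZeroTwoTwist`). [folklore] -/
abbrev adZeroOf {G : Type*} [Group G] {R : Type*} [CommRing R] (τ₀ : G →* GL (Fin 2) R) :
    G →* GL (Fin 3) R :=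
  (glAdZeroTwoFrame R).comp τ₀

/-- **`τ` is a twisted adjoint in the fixed frame**: `τ(g) = P · (η̄(g) · Ad(τ₀ g)) · P⁻¹` for one
`P ∈ GL₃(k)` and all `g` — the matrix form of "`τ ≅ η̄ ⊗ ad⁰(τ₀)`" (as an identity of matrices, so
that no representation-theoretic structure is needed on `τ`). [folklore] -/
def IsTwistedAdZero {G : Type*} [Group G] {k : Type*} [Field k] (τ : G →* GL (Fin 3) k)
    (τ₀ : G →* GL (Fin 2) k) (ηb : G →* GL (Fin 1) k) : Prop :=
  ∃ P : GL (Fin 3) k, ∀ g,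
    ((τ g : GL (Fin 3) k) : Matrix (Fin 3) (Fin 3) k) =
      (P : Matrix (Fin 3) (Fin 3) k) *
        ((((ηb g : GL (Fin 1) k) : Matrix (Fin 1) (Fin 1) k) 0 0) •
          ((adZeroOf τ₀ g : GL (Fin 3) k) : Matrix (Fin 3) (Fin 3) k)) *
        ((P⁻¹ : GL (Fin 3) k) : Matrix (Fin 3) (Fin 3) k)

/-- **Some `τ₀ g` has projective order `> 5`** (finite and at least `6`; `orderOf = 0` for elements
of infinite order, so `5 < orderOf _` forces finite order): the input `hord` of the accepted
Dickson theorem `PGL2.pslTwo_le_conj_le_pglTwo_of_five_le` — it excludes the projective images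
`A₄, S₄, A₅` (element orders `≤ 5`).  For `τ₀ = ρ̄₀` it comes from inertia at `p`
(Fontaine–Laffaille: projective inertia order `p − 1`, `p` or `p + 1 ≥ 10`). [folklore] -/
def HasProjOrderGtFive {G : Type*} [Group G] {k : Type*} [Field k] (τ₀ : G →* GL (Fin 2) k) :
    Prop :=
  ∃ g, 5 < orderOf (Matrix.ProjGenLinGroup.mk (τ₀ g))

/-- **Big projective image on `Γ_{ℚ(ζ_p)}`**: the projective image of `τ₀|_{Γ_{ℚ(ζ_p)}}` is
conjugate to a group between `PSL₂(𝔽)` and `PGL₂(𝔽)` for a finite subfield `𝔽` of `ℤ̄_p/𝔪` — the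
conclusion of the accepted Dickson theorem (`pslTwo`, `pglTwo` of
`Literature/GroupTheory/SpecificGroups/PGL2SubfieldCharP`; `projectiveImage` of `ProjectiveType`).
[cite: ACCGHLNSTT2023, §7.1, proof of Lemma 7.1.5 ("conjugate to PSL₂(k) or PGL₂(k)")] -/
def BigProjImageOnCyclotomic (p : ℕ) [Fact p.Prime]
    (τ₀ : absoluteGaloisGroup ℚ →* GL (Fin 2) (padicAlgClResidueField p)) : Prop :=
  ∃ (𝔽 : Subfield (padicAlgClResidueField p)) (t : PGL(Fin 2, padicAlgClResidueField p)),
    Finite 𝔽 ∧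
      Literature.GroupTheory.SpecificGroups.PGL2.pslTwo 𝔽 ≤
        MulAut.conj t • projectiveImage (τ₀.comp (absGaloisGroupAdjoinRootsOfUnity ℚ p).subtype) ∧
      MulAut.conj t • projectiveImage (τ₀.comp (absGaloisGroupAdjoinRootsOfUnity ℚ p).subtype) ≤
        Literature.GroupTheory.SpecificGroups.PGL2.pglTwo 𝔽

/-- **The `p`-adic cyclotomic character of `Γ_ℚ`, valued in `ℚ̄_p`** (`ε_p(σ) ∈ ℤ_pˣ ⊆ ℚ̄_p`; the
accepted `GaloisRep.cyclotomicCharacter ℚ p`, the spelling of route `PhantomRMYoshida`). [folklore] -/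
def cycPadicAlgCl (p : ℕ) [Fact p.Prime] (σ : absoluteGaloisGroup ℚ) : PadicAlgCl p :=
  algebraMap ℚ_[p] (PadicAlgCl p)
    (((GaloisRep.cyclotomicCharacter ℚ p σ : ℤ_[p]ˣ) : ℤ_[p]) : ℚ_[p])

/-- **A Teichmüller twist for `η`**: a FINITE-ORDER character `μ : Γ_ℚ → ℚ̄_pˣ`, UNRAMIFIED AT `p`,
with `μ ≡ η · ε_p (mod 𝔪)` — the lift of the residual character `η̄ ω̄` (which is unramified at `p`
because Fontaine–Laffaille forces `η̄|_{I_p} = ω⁻¹`); `π₀ = Ad(π_g) ⊗ μ` is then unramified at `p`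
and `μ ε⁻¹ ⊗ ad⁰ ρ_g ≡ η ⊗ ad⁰ ρ₀`. [folklore] -/
def TeichTwistFor (p : ℕ) [Fact p.Prime] (η μ : FramedGaloisRep ℚ (PadicAlgCl p) 1) : Prop :=
  (Set.range μ).Finite ∧
    (∀ v : HeightOneSpectrum (𝓞 ℚ), ((p : ℕ) : 𝓞 ℚ) ∈ v.asIdeal → μ.IsUnramifiedAt v) ∧
    ∀ σ, ‖(μ σ).val 0 0 - (η σ).val 0 0 * cycPadicAlgCl p σ‖ < 1

/-- **The mod-`p` cyclotomic character of `Γ_ℚ`, valued in `(ℤ/p)ˣ`** (Mathlib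
`modularCyclotomicCharacter` on `ℚ̄`, the spelling of route `PhantomRMYoshida`). [folklore] -/
def omegaModP (p : ℕ) [Fact p.Prime] : absoluteGaloisGroup ℚ →* (ZMod p)ˣ :=
  (modularCyclotomicCharacter (AlgebraicClosure ℚ)
      (HasEnoughRootsOfUnity.natCard_rootsOfUnity (AlgebraicClosure ℚ) p)).comp
    (MulSemiringAction.toRingAut (absoluteGaloisGroup ℚ) (AlgebraicClosure ℚ))

/-- **A weight-two newform for `ρ₀`, over the coefficient field `k`** (the output of
Khare–Wintenberger at Serre weight `2` for a Tate twist of `ρ̄₀`, in the tree's vocabulary of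
`SerreModularityConjecture` / `IsGaloisRepOfNewform1Int`): a level `M` PRIME TO `p`, a newform
`g ∈ S₂(Γ₁(M))` (`IsNewform1`), `ι_g : 𝓞_g → k`, an exponent `s`, a residual representation `τ₀` of
`ρ₀` and a continuous `σ̄ : Γ_ℚ → GL₂(k)` which IS `ω̄^s ⊗ τ₀` pushed into `k` along `ιk`, such that
`σ̄` is attached to `g` along `ι_g` away from `M p` (`charpoly σ̄(Frob_q) = ι_g(X² − a_q X + ε(q) q)`).
[cite: KhareWintenberger2009, Thm. 1.2] [cite: Serre1987, (3.2.4)] -/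
def WeightTwoNewformFor (p : ℕ) [Fact p.Prime] (ρ₀ : FramedGaloisRep ℚ (PadicAlgCl p) 2)
    (k : Type) [Field k] [CharP k p] [TopologicalSpace k] (ιk : padicAlgClResidueField p →+* k) :
    Prop :=
  ∃ (M : ℕ) (_ : NeZero M) (g : CuspForm (Gamma1 M) 2) (ιg : coeffCharIntegers g →+* k) (s : ℕ)
    (τ₀ : absoluteGaloisGroup ℚ →* GL (Fin 2) (padicAlgClResidueField p)) (σb : ModPGaloisRep ℚ k 2),
    ¬ p ∣ M ∧ IsNewform1 g ∧ IsGaloisRepOfNewform1Int g ιg {q | q ∣ M * p} σb ∧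
      ρ₀.IsResidualRepOf (RingHom.id _) τ₀ ∧
      ∀ γ, ((σb γ : GL (Fin 2) k) : Matrix (Fin 2) (Fin 2) k) =
        ((ZMod.castHom (dvd_refl p) k (((omegaModP p γ) ^ s : (ZMod p)ˣ) : ZMod p)) •
          ((τ₀ γ : GL (Fin 2) (padicAlgClResidueField p)) :
            Matrix (Fin 2) (Fin 2) (padicAlgClResidueField p)).map ιk)

/-- **The automorphic adjoint seed statement** (stub S5 of skeleton v4, as a `Prop`, so that the
Galois seed stub can take it as a hypothesis): for a newform `g ∈ S₂(Γ₁(M))`, a cuspidal `π` on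
`GL₂(𝔸_ℚ)` attached to `g` (Satake parameters the unitarily normalised Hecke roots at every
`v ∤ M`, Harish-Chandra parameter `{1/2, −1/2}` — the conclusion of the accepted
`exists_cuspidalAutomorphicRepData_newform`) with NO almost-everywhere quadratic self-twist, and a
finite-order Hecke character `χ` unramified at `p ∤ M`, there is a cuspidal `π₀` on `GL₃(𝔸_ℚ)` of
WEIGHT ZERO with Satake parameter `χ(ϖ_v) · Ad(t_{π,v})` at every place above `p` (so `π₀` is
UNRAMIFIED AT `p`) and at almost every place.  On paper: `π₀ = Ad(π) ⊗ χ`, Gelbart–Jacquet Thm. (9.3)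
(2)–(3) with (3.5) and Prop. (3.2) (archimedean parameter `{1, 0, −1}` = weight zero for `GL₃`),
Borel–Jacquet twists. [cite: GelbartJacquet1978, Thm. (9.3), (3.5), Prop. (3.2)]
[cite: Gelbart1997, Thm. 5.3.2] -/
def AutomorphicAdjointSeed (p : ℕ) [Fact p.Prime] : Prop :=
  ∀ (hcpt₂ : isCompact_glFiniteIntegralLevel 2 ℚ) (hcpt₃ : isCompact_glFiniteIntegralLevel 3 ℚ)
    (M : ℕ) [NeZero M] (g : CuspForm (Gamma1 M) 2), IsNewform1 g → ¬ p ∣ M →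
    ∀ (π : CuspidalAutomorphicRepData 2 ℚ hcpt₂),
      (∀ v : HeightOneSpectrum (𝓞 ℚ),
        ¬ ((Rat.HeightOneSpectrum.primesEquiv v : Nat.Primes) : ℕ) ∣ M →
          ∃ α : Multiset ℂ, π.1.HasSatakeParamAt v α ∧
            satakePolynomial α = Polynomial.X ^ 2 -
              Polynomial.C (heckeEigenvalue g ((Rat.HeightOneSpectrum.primesEquiv v : Nat.Primes) : ℕ) *
                (((Real.sqrt ((Rat.HeightOneSpectrum.primesEquiv v : Nat.Primes) : ℕ) : ℝ) : ℂ) ^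
                  (1 - (2 : ℤ)))) * Polynomial.X +
              Polynomial.C (nebentypus g
                ((((Rat.HeightOneSpectrum.primesEquiv v : Nat.Primes) : ℕ) : ℕ) : ZMod M))) →
      π.1.HasArchParameter (fun _ => ({(((2 : ℤ) : ℂ) - 1) / 2, (1 - ((2 : ℤ) : ℂ)) / 2} : Multiset ℂ)) →
      (∀ (K : Type) [Field K] [NumberField K] [Algebra ℚ K], Module.finrank ℚ K = 2 →
        ¬ IsQuadraticSelfTwistAE K π.1) →
    ∀ (χ : HeckeCharacter ℚ), χ.IsFiniteOrder →
      (∀ v : HeightOneSpectrum (𝓞 ℚ), ((p : ℕ) : 𝓞 ℚ) ∈ v.asIdeal → χ.IsUnramifiedAt v) →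
      ∃ π₀ : CuspidalAutomorphicRepData 3 ℚ hcpt₃, π₀.1.HasWeightZero ∧
        (∀ v : HeightOneSpectrum (𝓞 ℚ), ((p : ℕ) : 𝓞 ℚ) ∈ v.asIdeal →
          ∀ α : Multiset ℂ, π.1.HasSatakeParamAt v α →
            π₀.1.HasSatakeParamAt v ((adParams α).map (χ.valueAtUniformizer v * ·))) ∧
        ∀ᶠ v : HeightOneSpectrum (𝓞 ℚ) in Filter.cofinite, ∀ α : Multiset ℂ,
          π.1.HasSatakeParamAt v α →
            π₀.1.HasSatakeParamAt v ((adParams α).map (χ.valueAtUniformizer v * ·))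

end V4

/-! ## Glue: `Ad` kills the centre -/

section Glue

/-- **`Ad` of a scalar matrix is the identity**: `glAdZeroTwoFrame R (c · 1) = 1` (the explicit
matrix `adZeroTwoMatrixOf R P P⁻¹` of the accepted `coe_glAdZeroTwoFrame_apply` at `P = c · 1`,
`P⁻¹ = c⁻¹ · 1`). [folklore] -/
theorem glAdZeroTwoFrame_scalar {k : Type*} [Field k] (g : GL (Fin 2) k) (c : k)
    (hg : ((g : GL (Fin 2) k) : Matrix (Fin 2) (Fin 2) k) = c • (1 : Matrix (Fin 2) (Fin 2) k)) :
    glAdZeroTwoFrame k g = 1 := by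
  have hc : c ≠ 0 := by
    intro h0
    have hdet : ((g : GL (Fin 2) k) : Matrix (Fin 2) (Fin 2) k).det ≠ 0 :=
      (Matrix.GeneralLinearGroup.det g).ne_zero
    rw [hg, h0, zero_smul] at hdet
    exact hdet Matrix.det_zero
  have hinv : (((g⁻¹ : GL (Fin 2) k) : GL (Fin 2) k) : Matrix (Fin 2) (Fin 2) k) =
      c⁻¹ • (1 : Matrix (Fin 2) (Fin 2) k) := by
    have h1 : ((g : GL (Fin 2) k) : Matrix (Fin 2) (Fin 2) k) *
        (((g⁻¹ : GL (Fin 2) k) : GL (Fin 2) k) : Matrix (Fin 2) (Fin 2) k) = 1 := by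
      rw [← Units.val_mul, mul_inv_cancel, Units.val_one]
    rw [hg, Matrix.smul_mul, Matrix.one_mul] at h1
    have h2 := congrArg (fun M : Matrix (Fin 2) (Fin 2) k => c⁻¹ • M) h1
    simpa only [smul_smul, inv_mul_cancel₀ hc, one_smul] using h2
  refine Units.ext ?_
  rw [coe_glAdZeroTwoFrame_apply, hg, hinv, Units.val_one]
  ext i j
  fin_cases i <;> fin_cases j <;>
    simp [adZeroTwoMatrixOf, Matrix.smul_apply, hc]

/-- **A scalar `τ₀ σ` off `Γ_{ℚ(ζ_p)}` gives a scalar `τ σ` for every `τ = P(η̄ · Ad τ₀)P⁻¹`**: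
`Ad` kills the centre (`glAdZeroTwoFrame_scalar`), so `τ σ = P (η̄(σ) · 1) P⁻¹ = η̄(σ) · 1`.
This is how the scalar-element hypothesis (4) of ACC+ Thm. 6.1.1 for `ρ̄ ≅ η̄ ⊗ ad⁰(ρ̄₀)` is read
off the projective kernel of `ρ̄₀` (stub S3 of the line). [cite: ACCGHLNSTT2023, Rem. 6.1.4] -/
theorem scalarOffCyclotomic_of_isTwistedAdZero :
    ∀ {p : ℕ} [Fact p.Prime] {τ : absoluteGaloisGroup ℚ →* GL (Fin 3) (padicAlgClResidueField p)}
      {τ₀ : absoluteGaloisGroup ℚ →* GL (Fin 2) (padicAlgClResidueField p)}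
      {ηb : absoluteGaloisGroup ℚ →* GL (Fin 1) (padicAlgClResidueField p)},
      IsTwistedAdZero τ τ₀ ηb →
      (∃ σ : absoluteGaloisGroup ℚ, σ ∉ absGaloisGroupAdjoinRootsOfUnity ℚ p ∧
        ∃ c : padicAlgClResidueField p,
          ((τ₀ σ : GL (Fin 2) (padicAlgClResidueField p)) :
            Matrix (Fin 2) (Fin 2) (padicAlgClResidueField p)) = c • (1 : Matrix _ _ _)) →
      ScalarOffCyclotomic p τ := by
  intro p _ τ τ₀ ηb hform hsc
  obtain ⟨P, hP⟩ := hform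
  obtain ⟨σ, hσ, c, hc⟩ := hsc
  refine ⟨σ, hσ, (((ηb σ : GL (Fin 1) (padicAlgClResidueField p)) :
    Matrix (Fin 1) (Fin 1) (padicAlgClResidueField p)) 0 0), ?_⟩
  have had : adZeroOf τ₀ σ = 1 := by
    change glAdZeroTwoFrame (padicAlgClResidueField p) (τ₀ σ) = 1
    exact glAdZeroTwoFrame_scalar (τ₀ σ) c hc
  rw [hP σ, had, Units.val_one, Matrix.mul_smul, Matrix.mul_one, Matrix.smul_mul, ← Units.val_mul,
    mul_inv_cancel, Units.val_one]

end Glue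

end Summit.Langlands.Langlands.Cruxes.AdjointLiftingGL3.Birth

end
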